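import Summits.CriticalPhenomena.PercolationContinuityZ3.Theorems.Transplant.GrigorchukLamplighterDefs
import Mathlib.Algebra.Group.Subgroup.Ker
import Mathlib.Algebra.Group.Hom.Basic
import Mathlib.Tactic.Ring
import HarnessLib

/-!
# SCOPE RECORD: every character `Γ₂ = ℤ ≀_X 𝔊 → ℤ` is a multiple of the total lamp sum — `b₁(Γ₂) = 1`; so `Γ₂` itself carries NO rank-two character and the
# one-type scaled node's Cayley customers (U_s, «SkeletonFrmScaled1CustomersHoldsA»: two independent characters ON THE GROUP) have no input on any Cayley graph of `Γ₂`

builds on p205010 (kernel theorem, internal audit signed; external expert review pending) — nothing in this file uses p205010; pure group theory, no percolation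
statement, no node touched.  Lane `prim-bschramm`, seat `prim-bschramm-p3` gen 35 (DESIGN OWNER; `run/shared/lean/prim/bschramm/P3-NILPOTENT.md` §28 — the
scope record of the graph-level residual candidate `Cay(ℤ ≀_X 𝔊; a, b, c, d, s)`: 'U_s ✗ (b₁ = 1)' now in the kernel, next to 'N3 ✗' («…StandardGensNoGoHolds»
p592041)).  Helper file (`--supports stmt-CriticalPhenomena-4575 --as helper`).  Def-free.  ELEMENTARY (no torsion theorem needed): the five standard generators
`a, b, c, d, s` generate `Γ₂` (as a subgroup of itself), the four tree letters are involutions — so every homomorphism to the torsion-free `ℤ` kills them — and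
`s` has lamp sum `1`; two homomorphisms agreeing on generators agree.  NOTHING about growth; nothing about `BenjaminiSchramm1996_conj4_endState`; `θ(p_c) = 0` on
`Cay(ℤ ≀_X 𝔊; a, b, c, d, s)` stays NOT PROVED in the tree and not in print.
* `closure_standardGens : closure {aW, bW, cW, dW, sW} = ⊤`, `lampSumW` facts, `aW_mul_aW` … (involutions),
* **`hom_eq_zpow_lampSum (ψ : Γ₂ →* ℤ) : ψ = (· ^ ψ(s)) ∘ lampSum`**, **`hom_det_eq_zero`: any two characters of `Γ₂` are dependent (`ψ₀(x) ψ₁(y) = ψ₁(x) ψ₀(y)`)**.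
[cite: BartholdiErschler2012, §2 (standard generating set; W = Σ_X A ⋊ G), §3.1 (a, b, c, d involutions)] [cite: Grigorchuk1980, the generators are involutions]
[cite: BenjaminiSchramm1996, §2 (Cayley graphs)]
-/

noncomputable section

namespace Summit.CriticalPhenomena.PercolationContinuityZ3.Theorems.Transplant

namespace Grigorchuk

open scoped Classical

/-- **The standard generators `{a, b, c, d, s}` generate `Γ₂`** (as a subgroup of itself). [cite: BartholdiErschler2012, §2 (standard generating set)] -/
theorem closure_standardGens : Subgroup.closure ({aW, bW, cW, dW, sW} : Set ↥wreathZ) = ⊤ := by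
  have h := Subgroup.closure_closure_coe_preimage
    (k := ({tree genA, tree genB, tree genC, tree genD, lamp rho 1} : Set (LampGroup ℤ)))
  refine eq_top_iff.2 (le_trans (eq_top_iff.1 h) (Subgroup.closure_mono ?_))
  intro π hπ
  have hπ' : (π : LampGroup ℤ) ∈ ({tree genA, tree genB, tree genC, tree genD, lamp rho 1} : Set (LampGroup ℤ)) := hπ
  simp only [Set.mem_insert_iff, Set.mem_singleton_iff] at hπ' ⊢
  rcases hπ' with h | h | h | h | h
  · exact Or.inl (Subtype.ext h)
  · exact Or.inr (Or.inl (Subtype.ext h))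
  · exact Or.inr (Or.inr (Or.inl (Subtype.ext h)))
  · exact Or.inr (Or.inr (Or.inr (Or.inl (Subtype.ext h))))
  · exact Or.inr (Or.inr (Or.inr (Or.inr (Subtype.ext h))))

/-- **The total lamp sum `ε : Γ₂ → ℤ`** (restriction of `lampSum ℤ` to `Γ₂`). [cite: BartholdiErschler2012, §2 (W = Σ_X A ⋊ G; the projection to Σ A → A)] -/
theorem lampSum_sW : lampSum ℤ ((sW : ↥wreathZ) : LampGroup ℤ) = Multiplicative.ofAdd 1 := lampSum_lamp ℤ rho 1

/-- The tree letters have lamp sum `0`. [folklore] -/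
theorem lampSum_tree_letters :
    lampSum ℤ ((aW : ↥wreathZ) : LampGroup ℤ) = 1 ∧ lampSum ℤ ((bW : ↥wreathZ) : LampGroup ℤ) = 1 ∧
    lampSum ℤ ((cW : ↥wreathZ) : LampGroup ℤ) = 1 ∧ lampSum ℤ ((dW : ↥wreathZ) : LampGroup ℤ) = 1 :=
  ⟨lampSum_tree ℤ genA, lampSum_tree ℤ genB, lampSum_tree ℤ genC, lampSum_tree ℤ genD⟩

/-- **The tree letters are involutions in `Γ₂`.** [cite: Grigorchuk1980, a, b, c, d are involutions] -/
theorem tree_letters_sq : aW * aW = 1 ∧ bW * bW = 1 ∧ cW * cW = 1 ∧ dW * dW = 1 := by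
  have key : ∀ g : Equiv.Perm Ray, (∀ x, g (g x) = x) → (tree g * tree g : LampGroup ℤ) = 1 := by
    intro g hg
    rw [tree, ← map_mul, ← map_one (SemidirectProduct.inr)]
    congr 1
    exact Equiv.ext fun x => hg x
  refine ⟨?_, ?_, ?_, ?_⟩ <;> refine Subtype.ext ?_
  · exact key genA fun x => flipAt_involutive 0 x
  · exact key genB fun x => by rw [genB_apply, genB_apply]; exact sectionGen_involutive _ x
  · exact key genC fun x => by rw [genC_apply, genC_apply]; exact sectionGen_involutive _ x
  · exact key genD fun x => by rw [genD_apply, genD_apply]; exact sectionGen_involutive _ x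

/-- A homomorphism to `ℤ` kills an involution. [folklore] -/
theorem hom_eq_one_of_sq {G : Type} [Group G] (ψ : G →* Multiplicative ℤ) {g : G} (hg : g * g = 1) : ψ g = 1 := by
  have h : ψ g * ψ g = 1 := by rw [← map_mul, hg, map_one]
  have h2 : Multiplicative.toAdd (ψ g) + Multiplicative.toAdd (ψ g) = 0 := by
    rw [← toAdd_mul, h, toAdd_one]
  have h3 : Multiplicative.toAdd (ψ g) = 0 := by omega
  exact Multiplicative.toAdd.injective (by rw [h3, toAdd_one])

/-- **Every character of `Γ₂ = ℤ ≀_X 𝔊` is a multiple of the total lamp sum: `ψ = ε^{ψ(s)}`** (`b₁(Γ₂) = 1`).  Elementary: both sides agree on the generators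
`a, b, c, d` (involutions ↦ `1`; lamp sum `0`) and `s` (lamp sum `1`). [cite: BartholdiErschler2012, §2, §3.1] [cite: Grigorchuk1980, a, b, c, d are involutions] -/
theorem hom_eq_zpow_lampSum (ψ : ↥wreathZ →* Multiplicative ℤ) :
    ψ = (zpowGroupHom (Multiplicative.toAdd (ψ sW))).comp ((lampSum ℤ).comp wreathZ.subtype) := by
  refine MonoidHom.eq_of_eqOn_dense closure_standardGens ?_
  intro x hx
  simp only [Set.mem_insert_iff, Set.mem_singleton_iff] at hx
  obtain ⟨ha, hb, hc, hd⟩ := tree_letters_sq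
  obtain ⟨la, lb, lc, ld⟩ := lampSum_tree_letters
  rcases hx with rfl | rfl | rfl | rfl | rfl
  · simp only [MonoidHom.coe_comp, Function.comp_apply, Subgroup.coe_subtype, zpowGroupHom_apply, hom_eq_one_of_sq ψ ha, la, one_zpow]
  · simp only [MonoidHom.coe_comp, Function.comp_apply, Subgroup.coe_subtype, zpowGroupHom_apply, hom_eq_one_of_sq ψ hb, lb, one_zpow]
  · simp only [MonoidHom.coe_comp, Function.comp_apply, Subgroup.coe_subtype, zpowGroupHom_apply, hom_eq_one_of_sq ψ hc, lc, one_zpow]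
  · simp only [MonoidHom.coe_comp, Function.comp_apply, Subgroup.coe_subtype, zpowGroupHom_apply, hom_eq_one_of_sq ψ hd, ld, one_zpow]
  · simp only [MonoidHom.coe_comp, Function.comp_apply, Subgroup.coe_subtype, zpowGroupHom_apply, lampSum_sW]
    rw [← ofAdd_zsmul, smul_eq_mul, mul_one, ofAdd_toAdd]

/-- The character in coordinates: `ψ(x) = ψ(s) · ε(x)`. [cite: BartholdiErschler2012, §2] -/
theorem toAdd_hom_apply (ψ : ↥wreathZ →* Multiplicative ℤ) (x : ↥wreathZ) :
    Multiplicative.toAdd (ψ x) = Multiplicative.toAdd (ψ sW) * Multiplicative.toAdd (lampSum ℤ (x : LampGroup ℤ)) := by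
  conv_lhs => rw [hom_eq_zpow_lampSum ψ]
  simp only [MonoidHom.coe_comp, Function.comp_apply, Subgroup.coe_subtype, zpowGroupHom_apply, toAdd_zpow, smul_eq_mul]

/-- **Any two characters of `Γ₂` are dependent** (`b₁(Γ₂) = 1`): `ψ₀(x) ψ₁(y) = ψ₁(x) ψ₀(y)` — so no pair `(ψ₀, ψ₁)` on `Γ₂` meets the independence hypothesis of the
U_s Cayley customers / of «AutEndStateFCCayleyVFC» with `Γ₀ = Γ₂`; the rank-two data of `Γ₂` live on proper finite-index subgroups (the block characters of
`stabOneW`, «GrigorchukLamplighterDefs»). [cite: BartholdiErschler2012, §2] [cite: BenjaminiSchramm1996, §2 (Cayley graphs)] -/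
theorem hom_det_eq_zero (ψ₀ ψ₁ : ↥wreathZ →* Multiplicative ℤ) (x y : ↥wreathZ) :
    Multiplicative.toAdd (ψ₀ x) * Multiplicative.toAdd (ψ₁ y) = Multiplicative.toAdd (ψ₁ x) * Multiplicative.toAdd (ψ₀ y) := by
  rw [toAdd_hom_apply ψ₀ x, toAdd_hom_apply ψ₁ y, toAdd_hom_apply ψ₁ x, toAdd_hom_apply ψ₀ y]
  ring

end Grigorchuk

end Summit.CriticalPhenomena.PercolationContinuityZ3.Theorems.Transplant

end
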